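import Mathlib

/-!
# Route `NodalDiracTwist` — crux `NodalDiracWeakCoupling`, line `birth`: `stub_ellipseSqrt`

Helper file for stmt-HubbardSuperconductivity-10370 (`NodalDiracWeakCoupling`): the stub
`stub_ellipseSqrt` of the line `birth` — the half-angle around an ellipse. For a nondegenerate
real `2 × 2` pencil (`a₀ b₁ - a₁ b₀ ≠ 0`) the curve
`z(θ) = (a₀ cos θ + a₁ sin θ) + i (b₀ cos θ + b₁ sin θ)` is an ellipse winding once about `0`,
and `-z/|z|` has a continuous unit square root `E` along `ℝ` which is ANTIPERIODIC,
`E(θ + 2π) = -E(θ)`: the lower eigenvector `(Re E, Im E)` of the traceless symmetric pencil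
`[[a, b], [b, -a]]` changes sign around the loop (the Longuet-Higgins sign change, Berry phase
`π`, of a real eigenvector transported around a conical intersection).

Explicit construction (no covering-space theory): `z = c₊ e^{iθ} + c₋ e^{-iθ}` with
`|c₊|² - |c₋|² = a₀ b₁ - a₁ b₀`. If this is `> 0` then `z = c₊ u² f` with `u = e^{iθ/2}`,
`f = 1 + (c₋/c₊) u⁻⁴`, `Re f > 0`, so the principal branch `w = f^{1/2}` is continuous along
the curve, and `E = Y/|Y|` with `Y = γ u w`, `γ² = -c₊/|c₊|`, works: `u(θ + 2π) = -u(θ)` while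
`f`, `w` are `2π`-periodic, and `Y² = -(c₊/|c₊|) u² f = -z/|z| · |f|`. The case `< 0` follows
from the case `> 0` for `(a₀, -a₁, b₀, -b₁)` by `θ ↦ -θ`.

Sources: G. Herzberg, H. C. Longuet-Higgins, Discuss. Faraday Soc. 35 (1963) 77; M. V. Berry,
Proc. R. Soc. Lond. A 392 (1984) 45. No definitions.
-/

-- the mandated namespace `Summit.<Summit>.<Problem>.Theorems` repeats `HubbardSuperconductivity`
-- (single-problem summit, D-0017), which the `dupNamespace` linter flags on every declaration
set_option linter.dupNamespace false

namespace Summit.HubbardSuperconductivity.HubbardSuperconductivity.Theorems.NodalDiracTwist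

open Complex

/-- Antiperiodicity of the half-angle exponential: `e^{i(θ + 2π)/2} = -e^{iθ/2}`. [folklore] -/
theorem exp_half_angle_add_two_pi (θ : ℝ) :
    Complex.exp ((((θ + 2 * Real.pi) / 2 : ℝ) : ℂ) * I) =
      -Complex.exp (((θ / 2 : ℝ) : ℂ) * I) := by
  rw [← Complex.exp_add_pi_mul_I]
  congr 1
  push_cast
  ring

/-- `(e^{iθ/2})² = cos θ + i sin θ`. [folklore] -/
theorem exp_half_angle_sq (θ : ℝ) :
    Complex.exp (((θ / 2 : ℝ) : ℂ) * I) ^ 2 = (Real.cos θ : ℂ) + (Real.sin θ : ℂ) * I := by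
  rw [sq, ← Complex.exp_add]
  push_cast
  rw [← Complex.exp_mul_I]
  congr 1
  ring

/-- `(e^{iθ/2})⁻² = cos θ - i sin θ`. [folklore] -/
theorem exp_half_angle_sq_inv (θ : ℝ) :
    (Complex.exp (((θ / 2 : ℝ) : ℂ) * I) ^ 2)⁻¹ = (Real.cos θ : ℂ) - (Real.sin θ : ℂ) * I := by
  rw [sq, ← Complex.exp_add, ← Complex.exp_neg]
  push_cast
  rw [show -((θ : ℂ) / 2 * I + (θ : ℂ) / 2 * I) = (-(θ : ℂ)) * I by ring, Complex.exp_mul_I,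
    Complex.cos_neg, Complex.sin_neg]
  ring

/-- **The half-angle around an ellipse, positively oriented case.** For `0 < a₀ b₁ - a₁ b₀` the
unit complex number `-z(θ)/|z(θ)|`, `z(θ) = (a₀ cos θ + a₁ sin θ) + i (b₀ cos θ + b₁ sin θ)`, has
a continuous square root along `ℝ` which is antiperiodic of antiperiod `2π`. Explicitly
`z = c₊ u² (1 + (c₋/c₊) u⁻⁴)`, `u = e^{iθ/2}`, `|c₋| < |c₊|`, and
`E = Y/|Y|`, `Y = γ u (1 + (c₋/c₊) u⁻⁴)^{1/2}` (principal branch, continuous on `Re > 0`),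
`γ² = -c₊/|c₊|`. [folklore] -/
theorem ellipseSqrt_of_det_pos (a₀ a₁ b₀ b₁ : ℝ) (hdet : 0 < a₀ * b₁ - a₁ * b₀) :
    ∃ E : ℝ → ℂ, Continuous E ∧ (∀ θ : ℝ, ‖E θ‖ = 1) ∧
      (∀ θ : ℝ, E (θ + 2 * Real.pi) = -E θ) ∧
      ∀ θ : ℝ, E θ ^ 2 *
          ((Real.sqrt ((a₀ * Real.cos θ + a₁ * Real.sin θ) ^ 2 +
              (b₀ * Real.cos θ + b₁ * Real.sin θ) ^ 2) : ℝ) : ℂ) =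
        -(((a₀ * Real.cos θ + a₁ * Real.sin θ : ℝ) : ℂ) +
            ((b₀ * Real.cos θ + b₁ * Real.sin θ : ℝ) : ℂ) * Complex.I) := by
  -- Fourier coefficients of the ellipse: `z = cp e^{iθ} + cm e^{-iθ}`
  set cp : ℂ := ⟨(a₀ + b₁) / 2, (b₀ - a₁) / 2⟩ with hcp
  set cm : ℂ := ⟨(a₀ - b₁) / 2, (b₀ + a₁) / 2⟩ with hcm
  have hnorm : ‖cm‖ < ‖cp‖ := by
    have h1 : ‖cp‖ ^ 2 - ‖cm‖ ^ 2 = a₀ * b₁ - a₁ * b₀ := by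
      rw [Complex.sq_norm, Complex.sq_norm, hcp, hcm, Complex.normSq_mk, Complex.normSq_mk]
      ring
    nlinarith [norm_nonneg cp, norm_nonneg cm]
  have hcp0' : 0 < ‖cp‖ := lt_of_le_of_lt (norm_nonneg _) hnorm
  have hcp0 : cp ≠ 0 := norm_pos_iff.mp hcp0'
  -- the half-angle exponential
  set u : ℝ → ℂ := fun θ => Complex.exp (((θ / 2 : ℝ) : ℂ) * I) with hu
  have hu_cont : Continuous u := by
    rw [hu]
    fun_prop
  have hu1 : ∀ θ, ‖u θ‖ = 1 := fun θ => Complex.norm_exp_ofReal_mul_I _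
  have hu0 : ∀ θ, u θ ≠ 0 := fun θ => Complex.exp_ne_zero _
  have huper : ∀ θ, u (θ + 2 * Real.pi) = -u θ := fun θ => exp_half_angle_add_two_pi θ
  have hu2 : ∀ θ, u θ ^ 2 = (Real.cos θ : ℂ) + (Real.sin θ : ℂ) * I := fun θ =>
    exp_half_angle_sq θ
  have hu2i : ∀ θ, (u θ ^ 2)⁻¹ = (Real.cos θ : ℂ) - (Real.sin θ : ℂ) * I := fun θ =>
    exp_half_angle_sq_inv θ
  -- `f = 1 + q u⁻⁴`, with positive real part
  set q : ℂ := cm / cp with hq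
  have hq1 : ‖q‖ < 1 := by
    rw [hq, norm_div, div_lt_one hcp0']
    exact hnorm
  set f : ℝ → ℂ := fun θ => 1 + q * (u θ ^ 4)⁻¹ with hf
  have hf_re : ∀ θ, 0 < (f θ).re := by
    intro θ
    have h1 : ‖q * (u θ ^ 4)⁻¹‖ = ‖q‖ := by
      rw [norm_mul, norm_inv, norm_pow, hu1, one_pow, inv_one, mul_one]
    have h2 := abs_le.mp ((Complex.abs_re_le_norm (q * (u θ ^ 4)⁻¹)).trans_eq h1)
    simp only [hf, Complex.add_re, Complex.one_re]
    linarith [h2.1]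
  have hf0 : ∀ θ, f θ ≠ 0 := fun θ h => by
    have := hf_re θ
    rw [h, Complex.zero_re] at this
    exact lt_irrefl _ this
  have hf_cont : Continuous f :=
    continuous_const.add (continuous_const.mul ((hu_cont.pow 4).inv₀ fun θ =>
      pow_ne_zero _ (hu0 θ)))
  have hf_per : ∀ θ, f (θ + 2 * Real.pi) = f θ := by
    intro θ
    simp only [hf]
    rw [huper, show (-u θ) ^ 4 = u θ ^ 4 by ring]
  -- the principal square root of `f`
  set w : ℝ → ℂ := fun θ => (f θ) ^ (2⁻¹ : ℂ) with hw
  have hw2 : ∀ θ, w θ ^ 2 = f θ := fun θ => Complex.cpow_ofNat_inv_pow _ _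
  have hw0 : ∀ θ, w θ ≠ 0 := fun θ h => hf0 θ (by rw [← hw2 θ, h, zero_pow two_ne_zero])
  have hw_cont : Continuous w := by
    refine continuous_iff_continuousAt.mpr fun θ => ?_
    exact (continuousAt_cpow_const (Complex.mem_slitPlane_iff.mpr (Or.inl (hf_re θ)))).comp
      hf_cont.continuousAt
  have hw_per : ∀ θ, w (θ + 2 * Real.pi) = w θ := by
    intro θ
    show f (θ + 2 * Real.pi) ^ (2⁻¹ : ℂ) = f θ ^ (2⁻¹ : ℂ)
    rw [hf_per]
  -- the constant phase `γ`, `γ² = -cp/|cp|`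
  set γ : ℂ := (-(cp / ‖cp‖)) ^ (2⁻¹ : ℂ) with hγ
  have hγ2 : γ ^ 2 = -(cp / ‖cp‖) := Complex.cpow_ofNat_inv_pow _ _
  have hγn : ‖γ ^ 2‖ = 1 := by
    rw [hγ2, norm_neg, norm_div, Complex.norm_real, Real.norm_of_nonneg (norm_nonneg _),
      div_self hcp0'.ne']
  have hγ0 : γ ≠ 0 := fun h => by
    rw [h, zero_pow two_ne_zero, norm_zero] at hγn
    exact zero_ne_one hγn
  -- `Y = γ u w` and `E = Y/|Y|`
  set Y : ℝ → ℂ := fun θ => γ * u θ * w θ with hY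
  have hY0 : ∀ θ, Y θ ≠ 0 := fun θ => mul_ne_zero (mul_ne_zero hγ0 (hu0 θ)) (hw0 θ)
  have hY_cont : Continuous Y := (continuous_const.mul hu_cont).mul hw_cont
  have hYn0 : ∀ θ, ((‖Y θ‖ : ℝ) : ℂ) ≠ 0 := fun θ => by
    exact_mod_cast norm_ne_zero_iff.mpr (hY0 θ)
  refine ⟨fun θ => Y θ / ‖Y θ‖, ?_, ?_, ?_, ?_⟩
  · exact hY_cont.div (Complex.continuous_ofReal.comp hY_cont.norm) hYn0
  · intro θ
    dsimp only
    rw [norm_div, Complex.norm_real, norm_norm, div_self (norm_ne_zero_iff.mpr (hY0 θ))]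
  · intro θ
    dsimp only
    have : Y (θ + 2 * Real.pi) = -Y θ := by
      simp only [hY]
      rw [huper, hw_per]
      ring
    rw [this, norm_neg, neg_div]
  · intro θ
    dsimp only
    -- `z = cp u² f`
    have hz : ((a₀ * Real.cos θ + a₁ * Real.sin θ : ℝ) : ℂ) +
        ((b₀ * Real.cos θ + b₁ * Real.sin θ : ℝ) : ℂ) * I = cp * u θ ^ 2 * f θ := by
      have h1 : cp * u θ ^ 2 * f θ = cp * u θ ^ 2 + cm * (u θ ^ 2)⁻¹ := by
        have := hu0 θ
        simp only [hf, hq]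
        field_simp
      rw [h1, hu2i, hu2]
      apply Complex.ext <;> simp [hcp, hcm] <;> ring
    -- `|z| = |cp| |f|`
    have hnz : Real.sqrt ((a₀ * Real.cos θ + a₁ * Real.sin θ) ^ 2 +
        (b₀ * Real.cos θ + b₁ * Real.sin θ) ^ 2) = ‖cp‖ * ‖f θ‖ := by
      rw [← Complex.norm_add_mul_I, hz, norm_mul, norm_mul, norm_pow, hu1, one_pow, mul_one]
    have hY2 : Y θ ^ 2 = -(cp / ‖cp‖) * u θ ^ 2 * f θ := by
      simp only [hY]
      rw [mul_pow, mul_pow, hγ2, hw2]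
    have hY2n : ‖Y θ ^ 2‖ = ‖f θ‖ := by
      rw [hY2, norm_mul, norm_mul, ← hγ2, hγn, norm_pow, hu1, one_pow, one_mul, one_mul]
    have hE2 : (Y θ / ‖Y θ‖) ^ 2 = -(cp / ‖cp‖) * u θ ^ 2 * f θ / ‖f θ‖ := by
      rw [div_pow, ← Complex.ofReal_pow, ← norm_pow, hY2n, hY2]
    rw [hnz, hz, hE2]
    have hf0' : ((‖f θ‖ : ℝ) : ℂ) ≠ 0 := by exact_mod_cast norm_ne_zero_iff.mpr (hf0 θ)
    have hcp0'' : ((‖cp‖ : ℝ) : ℂ) ≠ 0 := by exact_mod_cast hcp0'.ne'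
    push_cast
    field_simp

/-- **STUB M3 — `stub_ellipseSqrt` (the half-angle around an ellipse).**
For a nondegenerate real `2 × 2` pencil (`a₀ b₁ - a₁ b₀ ≠ 0`) the curve
`z(θ) = (a₀ cos θ + a₁ sin θ) + i (b₀ cos θ + b₁ sin θ)` is an ellipse winding ONCE about `0`, and
`-z/|z|` has a continuous unit square root along `ℝ` which is ANTIPERIODIC, `E(θ + 2π) = -E(θ)`
(the lower eigenvector `(Re E, Im E)` of `[[a, b], [b, -a]]` changes sign around the loop).
Explicitly: `z = c₊ e^{iθ} + c₋ e^{-iθ}` with `|c₊|² - |c₋|² = a₀ b₁ - a₁ b₀`; if this is `> 0`,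
`E(θ) = γ e^{iθ/2} w(θ)/|γ e^{iθ/2} w(θ)|`, `w = (1 + (c₋/c₊) e^{-2iθ})^{1/2}` (principal branch,
continuous since `Re (1 + q e^{-2iθ}) > 0`), `γ² = -c₊/|c₊|` (`ellipseSqrt_of_det_pos`);
if `< 0`, apply this to `(a₀, -a₁, b₀, -b₁)` and reverse `θ ↦ -θ`.
Herzberg–Longuet-Higgins, Discuss. Faraday Soc. 35 (1963) 77; Berry, Proc. R. Soc. A 392 (1984)
45. [folklore] -/
theorem stub_ellipseSqrt (a₀ a₁ b₀ b₁ : ℝ) (hdet : a₀ * b₁ - a₁ * b₀ ≠ 0) :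
    ∃ E : ℝ → ℂ, Continuous E ∧ (∀ θ : ℝ, ‖E θ‖ = 1) ∧
      (∀ θ : ℝ, E (θ + 2 * Real.pi) = -E θ) ∧
      ∀ θ : ℝ, E θ ^ 2 *
          ((Real.sqrt ((a₀ * Real.cos θ + a₁ * Real.sin θ) ^ 2 +
              (b₀ * Real.cos θ + b₁ * Real.sin θ) ^ 2) : ℝ) : ℂ) =
        -(((a₀ * Real.cos θ + a₁ * Real.sin θ : ℝ) : ℂ) +
            ((b₀ * Real.cos θ + b₁ * Real.sin θ : ℝ) : ℂ) * Complex.I) := by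
  rcases lt_or_gt_of_ne hdet with hneg | hpos
  · -- negatively oriented: reverse the parametrisation of the positively oriented case
    obtain ⟨E, hEc, hEn, hEa, hEsq⟩ :=
      ellipseSqrt_of_det_pos a₀ (-a₁) b₀ (-b₁) (by linarith)
    refine ⟨fun θ => E (-θ), hEc.comp continuous_neg, fun θ => hEn _, fun θ => ?_, fun θ => ?_⟩
    · dsimp only
      have h := hEa (-(θ + 2 * Real.pi))
      rw [show -(θ + 2 * Real.pi) + 2 * Real.pi = -θ by ring] at h
      rw [h, neg_neg]
    · dsimp only
      have h := hEsq (-θ)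
      simp only [Real.cos_neg, Real.sin_neg, mul_neg, neg_mul, neg_neg] at h
      exact h
  · exact ellipseSqrt_of_det_pos a₀ a₁ b₀ b₁ hpos

end Summit.HubbardSuperconductivity.HubbardSuperconductivity.Theorems.NodalDiracTwist
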